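import Summits.QuantumFields.YangMills.Theorems.BalabanUVNodesN15VectorPieceSiteRel
import Summits.QuantumFields.YangMills.Theorems.BalabanUVNodesN15AtSpineCarriersVWordsAll
import Literature.MathematicalPhysics.QuantumFieldTheory.Balaban1983to89.B9Eq3130MatrixLetters

/-!
# Route «BalabanUVNodes», node N15 = NE2 — THE UNIT-LATTICE DATUM OF THE VECTOR PIECE INHABITED BY THE PIECE'S OWN `U ≡ 1` UNIT FORM (small weight `a`):
# `UnitDatumW` and `UnitRelDatum` WITNESSED (A2 non-vacuity certificates), and `N15At` — all three conjuncts by name — from the SITE datum `SiteRelDatum` ALONE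

Cell `pub-ymgap` (HUMAN RULING D-0062, Track A), seat `pub-ymgap-dag-n15-c` (generation g6; R134 (a) N15 NE2 s1).  Count-neutral; filed `--supports` the K3⁗ item
(`--as helper`).  Imports BY NAME, nothing in the tree modified: g5's R3s `…N15VectorPieceSiteRel` (`SiteRelDatum`, `n15At_vectorPiece_vWordsExpC_of_rel`), R3u
`…N15VectorPieceUnitRel` (`UnitRelDatum`, `vWGCVecUnitRelKernel`, `ne2PlusUnit_vectorPiece_vWordsExpC_rel`), U5 `…AtSpineCarriersVWordsAll` (`UnitDatumW`), U4
`…N15VectorPieceUnit` (`ne2PlusUnit_vectorPiece_vWordsGC`∕`…ExpC`), S1 `…N15BackgroundSiteNeumann` (`siteInv`, `comp_siteInv`, `isUnit_stepE`, `hasMaj_siteInv`), U1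
(`unitForm₀`), R1 (`hasMaj_idef_unitForm₀`), g3's `uniform_layer_v1M` (the -a piece's uniform `U ≡ 1` letters), g4 F4 (`card_fibre_kingPrV_lift`).

THE POINT (companion of the g6 erratum certificate `…N15VectorPieceSiteVacuity`).  The SITE datum of the piece (`siteForm₀ … ∘ W = 1`) is void; the UNIT datum is
NOT: the model's `U ≡ 1` unit form `K₀ = unitForm₀ a Q (G ⊗ 1) = a·1 − a²·Q(G ⊗ 1)Q*` (King's (2.14) shape at the piece) is `a·(1 − a·Q(G ⊗ 1)Q*)` and the
piece's plain majorant `G ⊗ 1 ≤ β·e^{−δd}` (uniform in the sized index, `uniform_layer_v1M`) makes `a·Q(G ⊗ 1)Q*` SMALL for `|a| ≤ a₀(β, δ, d)`; S1's Neumann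
device around `W = a⁻¹·1` then produces the inverse `ownUnitInv a Q (G ⊗ 1) := siteInv (a⁻¹·1) (a·1) K₀` with `K₀ ∘ ownUnitInv = 1` (`unitForm₀_comp_ownUnitInv`) and
the uniform decaying majorant `|a|⁻¹(1 − |a|βc_r²)⁻¹·e^{−(δ∕2)d}` (`hasMaj_ownUnitInv`), at both lattice spacings; R1's `hasMaj_idef_unitForm₀` supplies the η-defect
letter `𝔇(K₀′, K₀) ≤ a²m₀θ_j·e^{−δd}` of the own forms through King's pairing.  Hence:

* §1 (generic, namespace `…N15.SiteLayer`): `ownUnitInv`, `mulOp_const_comp_inv`, `hasMaj_mulOp_const`, `hasMaj_unitForm₀_sub`, ★ `unitForm₀_comp_ownUnitInv`,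
  ★ `hasMaj_ownUnitInv`.
* §2 (the vector piece ⊗ 1_𝔤, namespace `…N15.VectorPiece`): `ownUnitInvV a j` ∕ `ownUnitInvV' a j` (coarse ∕ fine), ★★ **`unitData_own`**: there is `a₀ > 0` (from the
  piece's uniform letters) such that for every weight `0 < |a| ≤ a₀` some `βU, δU > 0, M₀ ≥ 0` give BOTH `UnitDatumW a (ownUnitInvV a) (ownUnitInvV' a) βU δU` (U5's
  datum — an A2 NON-VACUITY CERTIFICATE for U4∕U5's displayed unit covariances) AND `UnitRelDatum (ownUnitInvV a) (ownUnitInvV' a) (own forms) βU δU M₀` (R3u's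
  datum at the piece's OWN forms, the three NE2⁰-type letters all PROVED).
* §3 faces: ★★ `ne2PlusUnit_vectorPiece_vWordsExpC_own` — `NE2PlusUnit c₃₅` BY NAME for the (3.60)-words family with the parallel-transport species, the unit
  covariances the piece's OWN inverses: NO `U ≡ 1` unit datum displayed (`0 < |a| ≤ a₀`); ★★★ **`n15At_vectorPiece_vWordsExpC_of_siteRel`** — `YMDAG.UVSplit.N15At`
  ALL THREE CONJUNCTS BY NAME from the SITE datum `SiteRelDatum` ALONE (operator = F16, site = R3s at the abstract `U ≡ 1` site forms, unit = R3u at the own forms);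
  closer `s_N15_of_vWordsExpCSiteRelReading`.

HONEST FRAMING.  The smallness `|a| ≤ a₀` is a restriction King's weight does not obey in general (his `a_k` is `O(1)` and his `C^{(k)} = (Δ^{(k)} + aL^{−2}Q*Q)⁻¹`
involves the FULL `G_k`, (2.14)∕(2.16) p.653): §2 is a NON-VACUITY certificate for the unit datum of THIS MODEL (one single-scale piece), not an identification
of King's covariance; the site side stays ABSTRACT (`SiteRelDatum`: the honest `U ≡ 1` site form needs the full propagator — g6 erratum certificate).  N15 NOT
discharged (0∕1); typed 28∕28 unmoved; one finite T⁴ programme at fixed ε — NOT ℝ⁴, NOT OS, NOT a mass gap, NOT Clay.  0 `sorry`, standard axioms; no decl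
below carries a cite tag asserting a printed statement.
-/

noncomputable section

open Finset

namespace Summit.QuantumFields.YangMills.BalabanUVNodes.N15.SiteLayer

open Literature.MathematicalPhysics.QuantumFieldTheory.Balaban1983to89
open Literature.MathematicalPhysics.QuantumFieldTheory.Balaban1983to89.B11SectG (BlockNorm HasMaj RowSum)
open Literature.MathematicalPhysics.QuantumFieldTheory.Balaban1983to89.T4EtaRateCoeffDefect (pull diagK hasMaj_pull hasMaj_mulOp)
open Literature.MathematicalPhysics.QuantumFieldTheory.Balaban1983to89.B6RandomWalk (Triangle254)
open Literature.MathematicalPhysics.QuantumFieldTheory.Balaban1983to89.B6Prop26Gluing (mulOp mulOp_apply)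
open Literature.MathematicalPhysics.QuantumFieldTheory.Balaban1983to89.B9Eq3130MatrixLetters (hasMaj_id_ofBlocks)
open Summit.QuantumFields.YangMills.BalabanUVNodes.N15.BackgroundLayer (fibAvg hasMaj_fibAvg)

/-! ## §1 The own inverse of the `U ≡ 1` unit form `a·1 − a²·QGQ*` for small `a` (S1's Neumann device around `a⁻¹·1`) -/

section OwnInverse

variable {X Y : Type} [Fintype X] [Fintype Y] [DecidableEq X] [DecidableEq Y] {g : B6.Geometry}

/-- THE OWN INVERSE of the `U ≡ 1` unit form: `(a·1 − a²QGQ*)⁻¹ := siteInv (a⁻¹·1) (a·1) (unitForm₀ a q G)` — S1's Neumann object `(1 − W(K₀ − K))⁻¹W` at `W = a⁻¹·1`,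
`K₀ = a·1`, `K = unitForm₀`. [cite: King1986, (2.14)+(2.16) p.653 (shapes: Δ^{(k)} and its resolvent); Balaban1985BackgroundPropagators, (3.67) p.403 (Neumann mechanism)] -/
def ownUnitInv (a : ℝ) (q : X → Y) (G : (X → ℝ) →ₗ[ℝ] (X → ℝ)) : (Y → ℝ) →ₗ[ℝ] (Y → ℝ) :=
  siteInv (mulOp fun _ : Y => a⁻¹) (mulOp fun _ : Y => a) (unitForm₀ a q G)

omit [Fintype Y] [DecidableEq Y] in
/-- `(a·1)(a⁻¹·1) = 1` for `a ≠ 0`. [folklore] -/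
theorem mulOp_const_comp_inv {a : ℝ} (ha : a ≠ 0) : mulOp (fun _ : Y => a) ∘ₗ mulOp (fun _ : Y => a⁻¹) = LinearMap.id := by
  refine LinearMap.ext fun v => funext fun y => ?_
  simp only [LinearMap.comp_apply, mulOp_apply, LinearMap.id_apply]
  rw [← mul_assoc, mul_inv_cancel₀ ha, one_mul]

omit [DecidableEq Y] in
/-- A constant multiplication operator `c·1` has the majorant `|c|·e^{−δd}` between the sharp block norms, for EVERY rate `δ` (it is diagonal; `d(y, y) = 0`). [folklore] -/
theorem hasMaj_mulOp_const (blkY : Y → g.Site) (hd0 : ∀ y : g.Site, g.dist y y = 0) (c δ : ℝ) :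
    HasMaj (BlockNorm.ofBlocks g blkY) (BlockNorm.ofBlocks g blkY) (mulOp fun _ : Y => c) (fun y y' => |c| * Real.exp (-(δ * g.dist y y'))) := by
  have h1 := hasMaj_id_ofBlocks blkY hd0 δ
  have h2 : HasMaj (BlockNorm.ofBlocks g blkY) (BlockNorm.ofBlocks g blkY) (mulOp fun _ : Y => c) (diagK fun _ => |c|) :=
    hasMaj_mulOp blkY (fun _ => abs_nonneg c) fun _ => le_rfl
  have h3 := hasMaj_diagK_comp_exp blkY (abs_nonneg c) h2 h1
  exact (h3.congr fun _ => rfl).mono fun y y' => le_of_eq (by ring)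

omit [DecidableEq X] in
/-- **`K₀ − a·1 = −a²·QGQ* ≤ a²β·e^{−δd}`** from the plain majorant `G ≤ β·e^{−δd}` (`Q, Q* ≤ diagK 1`; no row sum, no rate loss). [cite: King1986, (2.14) p.653 (shape)] -/
theorem hasMaj_unitForm₀_sub (blk : X → g.Site) (blkY : Y → g.Site) (q : X → Y) (hq : ∀ x, blk x = blkY (q x)) (a : ℝ)
    {G : (X → ℝ) →ₗ[ℝ] (X → ℝ)} {β δ : ℝ} (hβ : 0 ≤ β)
    (hG : HasMaj (BlockNorm.ofBlocks g blk) (BlockNorm.ofBlocks g blk) G (fun y y' => β * Real.exp (-(δ * g.dist y y')))) :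
    HasMaj (BlockNorm.ofBlocks g blkY) (BlockNorm.ofBlocks g blkY) (unitForm₀ a q G - mulOp fun _ : Y => a)
      (fun y y' => a * a * β * Real.exp (-(δ * g.dist y y'))) := by
  have hblk : blk = blkY ∘ q := funext hq
  subst hblk
  have hQ := hasMaj_fibAvg (g := g) (blkY ∘ q) blkY q fun _ => rfl
  have hQs : HasMaj (BlockNorm.ofBlocks g blkY) (BlockNorm.ofBlocks g (blkY ∘ q)) (pull q) (diagK fun _ => 1) := hasMaj_pull blkY q
  have t : HasMaj (BlockNorm.ofBlocks g blkY) (BlockNorm.ofBlocks g blkY) (fibAvg q ∘ₗ (G ∘ₗ pull q)) (fun y y' => 1 * (β * 1) * Real.exp (-(δ * g.dist y y'))) :=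
    hasMaj_diagK_comp_exp (blkY ∘ q) zero_le_one hQ (hasMaj_exp_comp_diagK (blkY ∘ q) hβ hG hQs)
  have hA : HasMaj (BlockNorm.ofBlocks g blkY) (BlockNorm.ofBlocks g blkY) (mulOp fun _ : Y => a * a) (diagK fun _ => a * a) :=
    hasMaj_mulOp blkY (fun _ => mul_self_nonneg a) fun _ => (abs_mul_self a).le
  have key := hasMaj_diagK_comp_exp blkY (mul_self_nonneg a) hA t
  have hEq : unitForm₀ a q G - mulOp (fun _ : Y => a) = -(mulOp (fun _ : Y => a * a) ∘ₗ (fibAvg q ∘ₗ (G ∘ₗ pull q))) := by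
    rw [unitForm₀]; abel
  rw [hEq]
  exact key.neg.mono fun y y' => le_of_eq (by ring)

variable (blkY : Y → g.Site) {σ cr : ℝ}

/-- The Neumann ratio of the own inverse: `|a⁻¹|·(a²β) = |a|·β`. [folklore] -/
theorem ownRatio_eq {a : ℝ} (ha : a ≠ 0) (β cr : ℝ) : |a⁻¹| * (a * a * β) * cr * cr = |a| * β * cr * cr := by
  have h : |a| ≠ 0 := abs_ne_zero.mpr ha
  have h2 : a * a = |a| * |a| := by rw [← abs_mul, abs_mul_self]
  rw [abs_inv, h2]
  field_simp

omit [DecidableEq X] in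
/-- ★ **`K₀ ∘ ownUnitInv = 1`**: the own inverse IS a right inverse of `a·1 − a²QGQ*` when `|a|·β·c_r² < 1` (`a ≠ 0`, `2σ ≤ δ`; S1 `comp_siteInv` + `isUnit_stepE`).
[cite: King1986, (2.16) p.653 (shape: the unit-lattice covariance as the inverse); Balaban1985BackgroundPropagators, (3.67) p.403 (Neumann mechanism)] -/
theorem unitForm₀_comp_ownUnitInv (blk : X → g.Site) (q : X → Y) (hq : ∀ x, blk x = blkY (q x)) (htri : Triangle254 g)
    (hd : ∀ a b : g.Site, 0 ≤ g.dist a b) (hd0 : ∀ y : g.Site, g.dist y y = 0) (hrow : RowSum g σ cr) (hσ : 0 ≤ σ) (hcr : 0 ≤ cr)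
    {a : ℝ} (ha : a ≠ 0) {G : (X → ℝ) →ₗ[ℝ] (X → ℝ)} {β δ : ℝ} (hβ : 0 ≤ β) (hσδ : 2 * σ ≤ δ)
    (hG : HasMaj (BlockNorm.ofBlocks g blk) (BlockNorm.ofBlocks g blk) G (fun y y' => β * Real.exp (-(δ * g.dist y y'))))
    (hsmall : |a| * β * cr * cr < 1) : unitForm₀ a q G ∘ₗ ownUnitInv a q G = LinearMap.id := by
  have hW := hasMaj_mulOp_const blkY hd0 a⁻¹ δ
  have hC : HasMaj (BlockNorm.ofBlocks g blkY) (BlockNorm.ofBlocks g blkY) (mulOp (fun _ : Y => a) - unitForm₀ a q G)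
      (fun y y' => a * a * β * Real.exp (-(δ * g.dist y y'))) :=
    (hasMaj_unitForm₀_sub blk blkY q hq a hβ hG).neg.congr fun μ => by rw [neg_sub]
  have hq1 : |a⁻¹| * (a * a * β) * cr * cr < 1 := by rw [ownRatio_eq ha]; exact hsmall
  have hunit := isUnit_stepE blkY htri hd hrow hσ (abs_nonneg a⁻¹) (mul_nonneg (mul_self_nonneg a) hβ) hcr (ρ₁ := δ - σ) (by linarith) (by linarith)
    (by linarith) hW hC hq1
  exact comp_siteInv hunit (mulOp_const_comp_inv ha)

omit [DecidableEq X] in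
/-- ★ **THE DRESSED (4.34)-TYPE MAJORANT OF THE OWN INVERSE**: `ownUnitInv ≤ |a|⁻¹(1 − |a|βc_r²)⁻¹·e^{−ρd}` for `ρ ≥ 0`, `ρ + 2σ ≤ δ` (S1 `hasMaj_siteInv`).
[cite: King1986, Lemma 4.5 (4.34) p.674 (shape: a decaying majorant of the unit-lattice covariance); Balaban1984PropagatorsII, (2.52)–(2.56) pp.232–233] -/
theorem hasMaj_ownUnitInv (blk : X → g.Site) (q : X → Y) (hq : ∀ x, blk x = blkY (q x)) (htri : Triangle254 g)
    (hd : ∀ a b : g.Site, 0 ≤ g.dist a b) (hd0 : ∀ y : g.Site, g.dist y y = 0) (hrow : RowSum g σ cr) (hσ : 0 ≤ σ) (hcr : 0 ≤ cr)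
    {a : ℝ} (ha : a ≠ 0) {G : (X → ℝ) →ₗ[ℝ] (X → ℝ)} {β δ ρ : ℝ} (hβ : 0 ≤ β) (hρ : 0 ≤ ρ) (hρδ : ρ + 2 * σ ≤ δ)
    (hG : HasMaj (BlockNorm.ofBlocks g blk) (BlockNorm.ofBlocks g blk) G (fun y y' => β * Real.exp (-(δ * g.dist y y'))))
    (hsmall : |a| * β * cr * cr < 1) :
    HasMaj (BlockNorm.ofBlocks g blkY) (BlockNorm.ofBlocks g blkY) (ownUnitInv a q G)
      (fun y y' => |a⁻¹| * (1 - |a| * β * cr * cr)⁻¹ * Real.exp (-(ρ * g.dist y y'))) := by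
  have hW := hasMaj_mulOp_const blkY hd0 a⁻¹ δ
  have hC := hasMaj_unitForm₀_sub blk blkY q hq a hβ hG
  have hq1 : |a⁻¹| * (a * a * β) * cr * cr < 1 := by rw [ownRatio_eq ha]; exact hsmall
  have key := hasMaj_siteInv blkY htri hd hrow hσ hcr (abs_nonneg a⁻¹) (mul_nonneg (mul_self_nonneg a) hβ) hρ hρδ hW hC hq1
  rw [ownRatio_eq ha] at key
  exact key

end OwnInverse

end Summit.QuantumFields.YangMills.BalabanUVNodes.N15.SiteLayer

namespace Summit.QuantumFields.YangMills.BalabanUVNodes.N15.VectorPiece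

open Literature.MathematicalPhysics.QuantumFieldTheory.Balaban1983to89
open Literature.MathematicalPhysics.QuantumFieldTheory.Balaban1983to89.B11SectG (BlockNorm HasMaj RowSum)
open Literature.MathematicalPhysics.QuantumFieldTheory.Balaban1983to89.T4Continuum
open Literature.MathematicalPhysics.QuantumFieldTheory.Balaban1983to89.T4EtaRate (NE2PlusUnit)
open Literature.MathematicalPhysics.QuantumFieldTheory.Balaban1983to89.T4EtaRateDefect (idef)
open Literature.MathematicalPhysics.QuantumFieldTheory.Balaban1983to89.B5Prop11Plancherel (Tor fine)
open Literature.MathematicalPhysics.QuantumFieldTheory.Balaban1983to89.B6UnitTorusCarrier (triangle254_unitTorusGeo rowSum_unitTorusGeo)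
open Literature.MathematicalPhysics.QuantumFieldTheory.King1986.Torus (tdistT tdistT_nonneg tdistT_self)
open Summit.QuantumFields.YangMills.BalabanUVNodes.N15.MatrixSpecies (liftMap liftBlk)
open Summit.QuantumFields.YangMills.BalabanUVNodes.N15.SiteLayer (unitForm₀ ownUnitInv unitForm₀_comp_ownUnitInv hasMaj_ownUnitInv hasMaj_idef_unitForm₀
  hasMaj_exp_mono)
open Summit.QuantumFields.YangMills.Theorems.N15AtSpineCarriers (UnitDatumW)
open YMDAG.UVSplit (N15At RateCarriers RateRecordPred S_N15 Datum)

variable {d : ℕ}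

/-! ## §2 The own unit inverses of the vector piece ⊗ 1_𝔤 at both spacings; `UnitDatumW` and `UnitRelDatum` witnessed -/

section Own

variable (ι : Type) [Fintype ι] [DecidableEq ι] (L : ℕ) [NeZero L] (a : ℝ)

/-- THE COARSE OWN UNIT INVERSE at a sized index: `(a·1 − a²·Q(G ⊗ 1)Q*)⁻¹` for the level-`L^k` piece, `Q` the block mean over `qbond`. [cite: King1986, (2.16) p.653 (shape)] -/
def ownUnitInvV (j : VecIndexS d L) : ((Tor j.Mn × Fin (d + 1)) × ι → ℝ) →ₗ[ℝ] ((Tor j.Mn × Fin (d + 1)) × ι → ℝ) :=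
  ownUnitInv a (liftMap (qbond L j.k j.Mn) ι) (tensorId ι (pieceG L j.Mn (L ^ j.k) j.k (rweight (d := d) L j.k)))

/-- THE FINE OWN UNIT INVERSE at a sized index (level `L^mL^k`, blocking through King's pairing). [cite: King1986, (2.16) p.653 (shape); p.664 (pairing)] -/
def ownUnitInvV' (j : VecIndexS d L) : ((Tor j.Mn × Fin (d + 1)) × ι → ℝ) →ₗ[ℝ] ((Tor j.Mn × Fin (d + 1)) × ι → ℝ) :=
  ownUnitInv a (liftMap (qbond L j.k j.Mn) ι ∘ liftMap (kingPrV L j.k j.m j.Mn) ι)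
    (tensorId ι (pieceG L j.Mn (L ^ j.m * L ^ j.k) (j.k + j.m) (rweight (d := d) L j.k / ((L : ℝ) ^ j.m) ^ (d + 1))))

variable {ι L a}

/-- ★★ **THE UNIT DATA OF THE PIECE, WITNESSED BY ITS OWN FORMS.**  For `d + 1 ≥ 2`, `L ≥ 1` there is `a₀ > 0` such that for every weight `a ≠ 0` with `|a| ≤ a₀`:
`UnitDatumW a (ownUnitInvV a) (ownUnitInvV' a) βU δU` (U5's datum) AND `UnitRelDatum (ownUnitInvV a) (ownUnitInvV' a) (unitForm₀ …) (unitForm₀′ …) βU δU M₀` (R3u's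
datum at the OWN forms) for some `βU ≥ 0`, `δU > 0`, `M₀ ≥ 0` uniform in the sized index — every NE2⁰-type unit letter a theorem: decaying inverse (S1 Neumann), inverse
identity, η-defect of the own forms (R1 `hasMaj_idef_unitForm₀` on g3's `𝔇(G′ ⊗ 1, G ⊗ 1)` letter). [cite: King1986, (2.14)+(2.16) p.653, Lemma 4.5 (4.34)+(4.38) p.674 (shapes)] -/
theorem unitData_own (hd : 1 ≤ d) (hL : 1 ≤ L) : ∃ a₀ : ℝ, 0 < a₀ ∧ ∀ a : ℝ, a ≠ 0 → |a| ≤ a₀ → ∃ βU δU M₀ : ℝ,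
    UnitDatumW (d := d) (ι := ι) (L := L) a (ownUnitInvV ι L a) (ownUnitInvV' ι L a) βU δU ∧
    UnitRelDatum (d := d) (ι := ι) (L := L) (ownUnitInvV ι L a) (ownUnitInvV' ι L a)
      (fun j => unitForm₀ a (liftMap (qbond L j.k j.Mn) ι) (tensorId ι (pieceG L j.Mn (L ^ j.k) j.k (rweight (d := d) L j.k))))
      (fun j => unitForm₀ a (liftMap (qbond L j.k j.Mn) ι ∘ liftMap (kingPrV L j.k j.m j.Mn) ι)
        (tensorId ι (pieceG L j.Mn (L ^ j.m * L ^ j.k) (j.k + j.m) (rweight (d := d) L j.k / ((L : ℝ) ^ j.m) ^ (d + 1))))) βU δU M₀ := by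
  obtain ⟨β, δ, m₀, hβ, hδ, hm₀, H⟩ := uniform_layer_v1M (d := d) (ι := ι) (L := L) hd hL
  -- row-sum rate σ = δ/4, inverse rate δ/2
  set σ : ℝ := δ / 4 with hσdef
  have hσ : 0 < σ := by positivity
  set cr : ℝ := B4Sect5Proof.latticeConst (d + 1) σ with hcrdef
  have hcr : 0 ≤ cr := B4Sect5Proof.latticeConst_nonneg (d + 1) hσ.le
  refine ⟨(2 * (β * cr * cr + 1))⁻¹, by positivity, fun a ha haa => ?_⟩
  have hapos : 0 < |a| := abs_pos.mpr ha
  have hsmall : |a| * β * cr * cr < 1 := by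
    have h1 : |a| * (β * cr * cr) ≤ (2 * (β * cr * cr + 1))⁻¹ * (β * cr * cr) := mul_le_mul_of_nonneg_right haa (by positivity)
    have h2 : (2 * (β * cr * cr + 1))⁻¹ * (β * cr * cr) < 1 := by
      rw [inv_mul_lt_iff₀ (by positivity)]; nlinarith [mul_nonneg (mul_nonneg hβ.le hcr) hcr]
    nlinarith
  have hq1 : 0 < 1 - |a| * β * cr * cr := by linarith
  set βU : ℝ := |a⁻¹| * (1 - |a| * β * cr * cr)⁻¹ with hβUdef
  have hβU : 0 ≤ βU := mul_nonneg (abs_nonneg _) (inv_nonneg.mpr hq1.le)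
  have hδ2 : 0 < δ / 2 := by positivity
  have hM₀ : 0 ≤ a * a * m₀ := mul_nonneg (mul_self_nonneg a) hm₀.le
  have hdist : ∀ (j : VecIndexS d L) (y y' : (unitTorusGeoS L j.k j.Mn j.Msz).Site), 0 ≤ (unitTorusGeoS L j.k j.Mn j.Msz).dist y y' :=
    fun j y y' => tdistT_nonneg _ _ _
  have hd0 : ∀ (j : VecIndexS d L) (y : (unitTorusGeoS L j.k j.Mn j.Msz).Site), (unitTorusGeoS L j.k j.Mn j.Msz).dist y y = 0 := fun j y => tdistT_self _ _
  -- coarse: inverse identity and majorant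
  have hKW : ∀ j : VecIndexS d L, unitForm₀ a (liftMap (qbond L j.k j.Mn) ι) (tensorId ι (pieceG L j.Mn (L ^ j.k) j.k (rweight (d := d) L j.k))) ∘ₗ
      ownUnitInvV ι L a j = LinearMap.id := fun j =>
    unitForm₀_comp_ownUnitInv (g := unitTorusGeoS L j.k j.Mn j.Msz) (liftBlk (fun b : Tor j.Mn × Fin (d + 1) => b.1) ι) (liftBlk (blkFine L j.k j.Mn) ι) (liftMap (qbond L j.k j.Mn) ι)
      (fun _ => rfl) (triangle254_unitTorusGeo L j.k j.Mn) (hdist j) (hd0 j) (rowSum_unitTorusGeo L j.k j.Mn hσ) hσ.le hcr ha hβ.le (by linarith)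
      (H j).1 hsmall
  have hWs : ∀ j : VecIndexS d L, HasMaj (BlockNorm.ofBlocks (unitTorusGeoS L j.k j.Mn j.Msz) (liftBlk (fun b : Tor j.Mn × Fin (d + 1) => b.1) ι))
      (BlockNorm.ofBlocks (unitTorusGeoS L j.k j.Mn j.Msz) (liftBlk (fun b : Tor j.Mn × Fin (d + 1) => b.1) ι)) (ownUnitInvV ι L a j)
      (fun y y' => βU * Real.exp (-(δ / 2 * (unitTorusGeoS L j.k j.Mn j.Msz).dist y y'))) := fun j =>
    hasMaj_ownUnitInv (g := unitTorusGeoS L j.k j.Mn j.Msz) (liftBlk (fun b : Tor j.Mn × Fin (d + 1) => b.1) ι) (liftBlk (blkFine L j.k j.Mn) ι) (liftMap (qbond L j.k j.Mn) ι)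
      (fun _ => rfl) (triangle254_unitTorusGeo L j.k j.Mn) (hdist j) (hd0 j) (rowSum_unitTorusGeo L j.k j.Mn hσ) hσ.le hcr ha hβ.le hδ2.le (by linarith)
      (H j).1 hsmall
  -- fine: inverse identity and majorant
  have hKW' : ∀ j : VecIndexS d L, unitForm₀ a (liftMap (qbond L j.k j.Mn) ι ∘ liftMap (kingPrV L j.k j.m j.Mn) ι)
      (tensorId ι (pieceG L j.Mn (L ^ j.m * L ^ j.k) (j.k + j.m) (rweight (d := d) L j.k / ((L : ℝ) ^ j.m) ^ (d + 1)))) ∘ₗ ownUnitInvV' ι L a j =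
      LinearMap.id := fun j =>
    unitForm₀_comp_ownUnitInv (g := unitTorusGeoS L j.k j.Mn j.Msz) (liftBlk (fun b : Tor j.Mn × Fin (d + 1) => b.1) ι) (liftBlk (blkFine L j.k j.Mn ∘ kingPrV L j.k j.m j.Mn) ι)
      (liftMap (qbond L j.k j.Mn) ι ∘ liftMap (kingPrV L j.k j.m j.Mn) ι)
      (fun _ => rfl) (triangle254_unitTorusGeo L j.k j.Mn) (hdist j) (hd0 j) (rowSum_unitTorusGeo L j.k j.Mn hσ) hσ.le hcr ha hβ.le (by linarith)
      (H j).2.2.1 hsmall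
  have hWs' : ∀ j : VecIndexS d L, HasMaj (BlockNorm.ofBlocks (unitTorusGeoS L j.k j.Mn j.Msz) (liftBlk (fun b : Tor j.Mn × Fin (d + 1) => b.1) ι))
      (BlockNorm.ofBlocks (unitTorusGeoS L j.k j.Mn j.Msz) (liftBlk (fun b : Tor j.Mn × Fin (d + 1) => b.1) ι)) (ownUnitInvV' ι L a j)
      (fun y y' => βU * Real.exp (-(δ / 2 * (unitTorusGeoS L j.k j.Mn j.Msz).dist y y'))) := fun j =>
    hasMaj_ownUnitInv (g := unitTorusGeoS L j.k j.Mn j.Msz) (liftBlk (fun b : Tor j.Mn × Fin (d + 1) => b.1) ι) (liftBlk (blkFine L j.k j.Mn ∘ kingPrV L j.k j.m j.Mn) ι)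
      (liftMap (qbond L j.k j.Mn) ι ∘ liftMap (kingPrV L j.k j.m j.Mn) ι)
      (fun _ => rfl) (triangle254_unitTorusGeo L j.k j.Mn) (hdist j) (hd0 j) (rowSum_unitTorusGeo L j.k j.Mn hσ) hσ.le hcr ha hβ.le hδ2.le (by linarith)
      (H j).2.2.1 hsmall
  -- the η-defect of the own forms (R1) at the rate δ, weakened to δ/2
  have hDK : ∀ j : VecIndexS d L, HasMaj (BlockNorm.ofBlocks (unitTorusGeoS L j.k j.Mn j.Msz) (liftBlk (fun b : Tor j.Mn × Fin (d + 1) => b.1) ι))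
      (BlockNorm.ofBlocks (unitTorusGeoS L j.k j.Mn j.Msz) (liftBlk (fun b : Tor j.Mn × Fin (d + 1) => b.1) ι))
      (idef LinearMap.id LinearMap.id
        (unitForm₀ a (liftMap (qbond L j.k j.Mn) ι ∘ liftMap (kingPrV L j.k j.m j.Mn) ι)
          (tensorId ι (pieceG L j.Mn (L ^ j.m * L ^ j.k) (j.k + j.m) (rweight (d := d) L j.k / ((L : ℝ) ^ j.m) ^ (d + 1)))))
        (unitForm₀ a (liftMap (qbond L j.k j.Mn) ι) (tensorId ι (pieceG L j.Mn (L ^ j.k) j.k (rweight (d := d) L j.k)))))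
      (fun y y' => a * a * m₀ * thetaV L j * Real.exp (-(δ / 2 * (unitTorusGeoS L j.k j.Mn j.Msz).dist y y'))) := fun j => by
    have hθ : 0 ≤ thetaV L j := by unfold thetaV; positivity
    have key := hasMaj_idef_unitForm₀ (g := unitTorusGeoS L j.k j.Mn j.Msz) (liftBlk (blkFine L j.k j.Mn) ι) (liftBlk (fun b : Tor j.Mn × Fin (d + 1) => b.1) ι)
      (liftMap (qbond L j.k j.Mn) ι) (liftMap (kingPrV L j.k j.m j.Mn) ι) (fun _ => rfl) (pow_ne_zero _ (pow_ne_zero _ (NeZero.ne L)))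
      (card_fibre_kingPrV_lift L j.k j.m j.Mn ι) a (mul_nonneg hm₀.le hθ) (H j).2.2.2.2.2.2.2.1
    have key' := hasMaj_exp_mono (hdist j) (mul_nonneg (mul_self_nonneg a) (mul_nonneg hm₀.le hθ)) (show δ / 2 ≤ δ by linarith) key
    exact key'.mono fun y y' => le_of_eq (by ring)
  exact ⟨βU, δ / 2, a * a * m₀, ⟨hβU, hδ2, hWs, hWs', hKW, hKW'⟩, ⟨hβU, hδ2, hM₀, hWs, hWs', hKW, hKW', hDK⟩⟩

variable (ι L)

/-- THE CERTIFIED WEIGHT WINDOW `a₀ > 0` of `unitData_own` (a choice; depends on the piece's uniform `U ≡ 1` letters only). [bookkeeping] -/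
def ownWeightBound (hd : 1 ≤ d) (hL : 1 ≤ L) : ℝ := Classical.choose (unitData_own (d := d) (ι := ι) (L := L) hd hL)

/-- `a₀ > 0`. [bookkeeping] -/
theorem ownWeightBound_pos (hd : 1 ≤ d) (hL : 1 ≤ L) : 0 < ownWeightBound (d := d) ι L hd hL :=
  (Classical.choose_spec (unitData_own (d := d) (ι := ι) (L := L) hd hL)).1

/-- In the window `0 < |a| ≤ a₀` both unit data are witnessed by the own forms. [bookkeeping] -/
theorem unitData_of_le_ownWeightBound (hd : 1 ≤ d) (hL : 1 ≤ L) {a : ℝ} (ha : a ≠ 0) (haa : |a| ≤ ownWeightBound (d := d) ι L hd hL) :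
    ∃ βU δU M₀ : ℝ,
      UnitDatumW (d := d) (ι := ι) (L := L) a (ownUnitInvV ι L a) (ownUnitInvV' ι L a) βU δU ∧
      UnitRelDatum (d := d) (ι := ι) (L := L) (ownUnitInvV ι L a) (ownUnitInvV' ι L a)
        (fun j => unitForm₀ a (liftMap (qbond L j.k j.Mn) ι) (tensorId ι (pieceG L j.Mn (L ^ j.k) j.k (rweight (d := d) L j.k))))
        (fun j => unitForm₀ a (liftMap (qbond L j.k j.Mn) ι ∘ liftMap (kingPrV L j.k j.m j.Mn) ι)
          (tensorId ι (pieceG L j.Mn (L ^ j.m * L ^ j.k) (j.k + j.m) (rweight (d := d) L j.k / ((L : ℝ) ^ j.m) ^ (d + 1))))) βU δU M₀ :=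
  (Classical.choose_spec (unitData_own (d := d) (ι := ι) (L := L) hd hL)).2 a ha haa

end Own

/-! ## §3 Faces: `NE2PlusUnit` with NO unit datum displayed; `N15At` from the SITE datum `SiteRelDatum` alone -/

section Faces

variable (𝔄 : Type) [NormedRing 𝔄] [NormedAlgebra ℝ 𝔄] [CompleteSpace 𝔄] (ι : Type) [Fintype ι] [DecidableEq ι] (e : 𝔄 ≃L[ℝ] (ι → ℝ)) (L : ℕ) [NeZero L]

/-- ★★ **`NE2PlusUnit` BY NAME WITH THE UNIT COVARIANCES THE PIECE'S OWN INVERSES** (parallel-transport species; `d + 1 ≥ 2`, `L ≥ 2`, `c₃₅ > 0`, weight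
`0 < |a| ≤ a₀`): NO `U ≡ 1` unit datum displayed (R3u's `ne2PlusUnit_vectorPiece_vWordsExpC_rel` at `unitData_own`). [cite: Balaban1985BackgroundPropagators, Thm 3.15 (3.187) p.432 (quantifier template); King1986, Lemma 4.5 (4.38) p.674 (A = 0 template)] -/
theorem ne2PlusUnit_vectorPiece_vWordsExpC_own (hd : 1 ≤ d) (hL : 1 ≤ L) (hL2 : 2 ≤ L) (c35 : ℝ) (hc35 : 0 < c35) {a : ℝ} (ha : a ≠ 0)
    (haa : |a| ≤ ownWeightBound (d := d) ι L hd hL) :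
    NE2PlusUnit c35 (v1GVecInstance (d := d) 𝔄 ι L hL)
      (vWGCVecUnitRelKernel (d := d) 𝔄 ι e L a hL (expFc ι e L) (expFsc ι e L) (expFf ι e L) (expFsf ι e L) (ownUnitInvV ι L a) (ownUnitInvV' ι L a)
        (fun j => unitForm₀ a (liftMap (qbond L j.k j.Mn) ι) (tensorId ι (pieceG L j.Mn (L ^ j.k) j.k (rweight (d := d) L j.k))))
        (fun j => unitForm₀ a (liftMap (qbond L j.k j.Mn) ι ∘ liftMap (kingPrV L j.k j.m j.Mn) ι)
          (tensorId ι (pieceG L j.Mn (L ^ j.m * L ^ j.k) (j.k + j.m) (rweight (d := d) L j.k / ((L : ℝ) ^ j.m) ^ (d + 1))))))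
      (fun _ _ => True) (fun j => (unitTorusGeoS L j.k j.Mn j.Msz).dist) := by
  obtain ⟨βU, δU, M₀, -, hβU, hδU, hM₀, hWs, hWs', hKW, hKW', hDK⟩ := unitData_of_le_ownWeightBound (d := d) ι L hd hL ha haa
  exact ne2PlusUnit_vectorPiece_vWordsExpC_rel (d := d) e a hd hL hL2 c35 hc35 _ _ _ _ hβU hδU hM₀ hWs hWs' hKW hKW' hDK

/-- ★★★ **`N15At` — ALL THREE CONJUNCTS BY NAME FROM THE SITE DATUM ALONE** (parallel-transport species; `d + 1 ≥ 2`, `L ≥ 2`, `c₃₅ > 0`, any `p`, weight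
`0 < |a| ≤ a₀`): R3s's `n15At_vectorPiece_vWordsExpC_of_rel` with its unit datum DISCHARGED by `unitData_own` — operator = F16, site = R3s at the abstract `U ≡ 1` site
forms `Ks, Ks′` (the one datum that CANNOT be the piece's own form: g6 erratum certificate), unit = R3u at the piece's own unit forms. [bookkeeping] -/
theorem n15At_vectorPiece_vWordsExpC_of_siteRel (hd : 1 ≤ d) (hL : 1 ≤ L) (hL2 : 2 ≤ L) {c35 : ℝ} (hc35 : 0 < c35) (p : ℝ) {a : ℝ} (ha : a ≠ 0)
    (haa : |a| ≤ ownWeightBound (d := d) ι L hd hL)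
    {WsS WsS' Ks Ks' : ∀ j : VecIndexS d L, ((Tor j.Mn × Fin (d + 1)) × ι → ℝ) →ₗ[ℝ] ((Tor j.Mn × Fin (d + 1)) × ι → ℝ)} {βS δS MS : ℝ}
    (hS : SiteRelDatum (d := d) (ι := ι) (L := L) WsS WsS' Ks Ks' βS δS MS) :
    N15At { I := VecIndexS d L, c35 := c35, p := p, pi := v1GVecInstance (d := d) 𝔄 ι L hL,
            Kop := vWGCVecFamily4 (d := d) 𝔄 ι e L a hL (expFc ι e L) (expFsc ι e L) (expFf ι e L) (expFsf ι e L),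
            Ksite := vWGCVecSiteRelKernel (d := d) 𝔄 ι e L a hL (expFc ι e L) (expFsc ι e L) (expFf ι e L) (expFsf ι e L) WsS WsS' Ks Ks',
            Kunit := vWGCVecUnitRelKernel (d := d) 𝔄 ι e L a hL (expFc ι e L) (expFsc ι e L) (expFf ι e L) (expFsf ι e L)
              (ownUnitInvV ι L a) (ownUnitInvV' ι L a)
              (fun j => unitForm₀ a (liftMap (qbond L j.k j.Mn) ι) (tensorId ι (pieceG L j.Mn (L ^ j.k) j.k (rweight (d := d) L j.k))))
              (fun j => unitForm₀ a (liftMap (qbond L j.k j.Mn) ι ∘ liftMap (kingPrV L j.k j.m j.Mn) ι)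
                (tensorId ι (pieceG L j.Mn (L ^ j.m * L ^ j.k) (j.k + j.m) (rweight (d := d) L j.k / ((L : ℝ) ^ j.m) ^ (d + 1))))),
            inΛ := fun _ _ => True, unitDist := fun j => (unitTorusGeoS L j.k j.Mn j.Msz).dist } := by
  obtain ⟨βU, δU, M₀, -, hU⟩ := unitData_of_le_ownWeightBound (d := d) ι L hd hL ha haa
  exact n15At_vectorPiece_vWordsExpC_of_rel (d := d) e a hd hL hL2 hc35 p hS hU

variable {N : ℕ} [NeZero N] in
/-- **`S_N15` FOR EVERY PARALLEL-TRANSPORT-SPECIES READING CARRYING ONLY THE SITE DATUM** (weight in the certified window): the K4 stub closed over every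
rate-carrier predicate whose NE2 component is the record above — operator and unit layers hypothesis-free; site layer on abstract `U ≡ 1` forms. [bookkeeping] -/
theorem s_N15_of_vWordsExpCSiteRelReading (hd : 1 ≤ d) (hL : 1 ≤ L) (hL2 : 2 ≤ L) (RRec : RateRecordPred N)
    (hread : ∀ (F : T4Family) (D : Datum F N) (g₀ : ℕ → ℝ) (os : List (ULoop F)) (R : RateCarriers N), RRec F D g₀ os R →
      ∃ (a c35 p βS δS MS : ℝ) (WsS WsS' Ks Ks' : ∀ j : VecIndexS d L, ((Tor j.Mn × Fin (d + 1)) × ι → ℝ) →ₗ[ℝ] ((Tor j.Mn × Fin (d + 1)) × ι → ℝ)),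
        a ≠ 0 ∧ |a| ≤ ownWeightBound (d := d) ι L hd hL ∧ 0 < c35 ∧ SiteRelDatum (d := d) (ι := ι) (L := L) WsS WsS' Ks Ks' βS δS MS ∧
        R.ne2 = { I := VecIndexS d L, c35 := c35, p := p, pi := v1GVecInstance (d := d) 𝔄 ι L hL,
                  Kop := vWGCVecFamily4 (d := d) 𝔄 ι e L a hL (expFc ι e L) (expFsc ι e L) (expFf ι e L) (expFsf ι e L),
                  Ksite := vWGCVecSiteRelKernel (d := d) 𝔄 ι e L a hL (expFc ι e L) (expFsc ι e L) (expFf ι e L) (expFsf ι e L) WsS WsS' Ks Ks',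
                  Kunit := vWGCVecUnitRelKernel (d := d) 𝔄 ι e L a hL (expFc ι e L) (expFsc ι e L) (expFf ι e L) (expFsf ι e L)
                    (ownUnitInvV ι L a) (ownUnitInvV' ι L a)
                    (fun j => unitForm₀ a (liftMap (qbond L j.k j.Mn) ι) (tensorId ι (pieceG L j.Mn (L ^ j.k) j.k (rweight (d := d) L j.k))))
                    (fun j => unitForm₀ a (liftMap (qbond L j.k j.Mn) ι ∘ liftMap (kingPrV L j.k j.m j.Mn) ι)
                      (tensorId ι (pieceG L j.Mn (L ^ j.m * L ^ j.k) (j.k + j.m) (rweight (d := d) L j.k / ((L : ℝ) ^ j.m) ^ (d + 1))))),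
                  inΛ := fun _ _ => True, unitDist := fun j => (unitTorusGeoS L j.k j.Mn j.Msz).dist }) :
    S_N15 RRec := by
  intro F D g₀ os R hR
  obtain ⟨a, c35, p, βS, δS, MS, WsS, WsS', Ks, Ks', ha, haa, hc35, hSd, hne2⟩ := hread F D g₀ os R hR
  rw [hne2]
  exact n15At_vectorPiece_vWordsExpC_of_siteRel 𝔄 ι e L hd hL hL2 hc35 p ha haa hSd

end Faces

end Summit.QuantumFields.YangMills.BalabanUVNodes.N15.VectorPiece

end
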